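/-
Origin: expansion seat `planner-pub-hodgecm-mc-axioms-1-g14-0`, handover #W36 2026-08-20T15:53:55Z md5 4a0fd1b7bc9e (PKG d6f8abd96d51 → 4a0fd1b7bc9e; 102 l.; MECHANICAL (iib-R) rewrite v3.1 of the PKG file as it stands (14 token edits; rules R9+R1x1+RX[h₂']x5+R3x1+R8x5)) (`HOME/mc/pub-hodgecm-mc-axioms-1-g14/revendor/kit-r55/stage55/HodgeCM/Model/CMInflationRiemann.lean`, md5 4a0fd1b7bc9e, 102 lines);
landed by the gen-22 packager (p-g22) in gate run 55 REPLACES the earlier landed copy of `HodgeCM/Model/CMInflationRiemann.lean` (seat copy carried the packager Origin header of an earlier run (stripped)).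
-/
/-
Copyright (c) 2026. All rights reserved.
Released under Apache 2.0 license as described in the file LICENSE.
Authors: mc-axioms-1 lineage (gen 4), PerL model-construction cell.
-/
import Summits.HodgeConjecture.HodgeCM.Model.CMInflation
import Literature.AlgebraicGeometry.ComplexMultiplication.ShimuraInflationRationalOfRiemann
import Literature.AlgebraicGeometry.HodgeTheory.AbelianVarietyHodgeFullnessRecord

/-!
# G0-(v5) rev 3 — M38 `Fact_cmInflation` on the model universe FROM RIEMANN'S THEOREM (binder route (X-riem))

MODEL-DAG node D3-geom, deliverable (v5), BINDER-TRIAGE §32b.2 (`h31.hd` leaves the ledger under (X-riem)).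
The `ThetaModel` field M38 `Fact_cmInflation` of the end-state universe `picardCMUniverse hHD hI h₁ h₃` —
for `k : K →+* M` and a CM type `Φ` of `K`, rational `H¹` of `A_{(M, Φ^M)}` is the direct sum of finitely
many pull-backs of `H¹(A_{(K,Φ)})`, `K`-equivariantly — is the tree theorem
`Literature.AlgebraicGeometry.ComplexMultiplication.thm3_rational_transport_of_riemann`
(KERNEL, record-free; tree file `Literature/AlgebraicGeometry/ComplexMultiplication/ShimuraInflationRationalOfRiemann.lean`,
vendored twin imported above) applied to the CHOSEN realisations `cmRealisation h₃ (cmCode K Φ)`,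
`cmRealisation h₃ (cmCode M Φ^M)` of record (iii) `PicardCM.CMAbelianVarietyRealised`, read along the code
isomorphisms `cmCodeEquiv`; its explicit Riemann hypothesis (fullness for abelian varieties carrying Hodge
models, Hodge-morphism premise spelled out) is fed from the record `hR` by the one-line lambda
`fun A B ψ _ hB hA₁ hA₂ ↦ hR A B ψ hB ⟨hA₁, hA₂⟩` (of the two `Nonempty (HodgeModel _ _)` premises, which
the tree theorem discharges from the realisations, the one on the source `A` is dropped and the one on
`B` is passed to the record as RE-TYPED after ROUND 47 G-1, premise `Nonempty (HodgeModel B.dim B.X) →`).  Its ONLY inputs beyond the universe's own rows `hHD`, `hI`, (iii) are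

* `hR : Literature.AlgebraicGeometry.HodgeTheory.DeligneMilne1982_Thm_6_20_full` — PRINT (binder type P,
  MODEL-N row N-G0-riem): Deligne–Milne 1982 (LNM 900, *Tannakian Categories*) Theorem 6.20 (Riemann),
  fullness conjunct — «the functor `A ↦ H¹_B(A, ℚ)` from the category of complex abelian varieties up to
  isogeny to polarisable rational Hodge structures of weight one is fully faithful», typed in the tree record
  `Literature/AlgebraicGeometry/HodgeTheory/AbelianVarietyHodgeFullnessRecord.lean` (p181421) as: a `ℚ`-linear
  `ψ : H¹(B(ℂ); ℚ) → H¹(A(ℂ); ℚ)` whose complexification respects the Hodge types `(1,0)`, `(0,1)` is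
  `k⁻¹ u^*` for a homomorphism `u : A → B` and an integer `k ≥ 1`;
* `hI : hodgePQ_independent_of_hodgeModel` — already a row of the universe (Voisin I Prop. 6.11).

Compared with rev 1 `HodgeCM.Model.fact_cmInflation … hd ha hb hc` (`CMInflation.lean`) and rev 2
`fact_cmInflation_printed … hd ha` (`CMInflationPrinted.lean`), the OPEN JUNCTION HYPOTHESIS
`hd : Shimura1998_Thm3_isogenousPower` and the record `ha : Shimura1998_Thm2_Cor` are GONE: no isogeny
`A′ ∼ B^h`, no product of abelian varieties, no uniqueness up to isogeny is used — `K`-linear algebra on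
`H¹(−, ℚ)`, the eigen-decomposition of `H¹(−, ℂ)` with its Hodge types read in one fixed Hodge model, and
Riemann's theorem.  Revs 1 and 2 are kept as they are (this leaf is ADDITIVE).

END-STATE TERM (node E, binder `h31` of `perL_picardCM_r4`, E rev-3e):
`HodgeCM.Model.fact_cmInflation_riemann hHD hI h₃ h₁ hR : (picardCMUniverse hHD hI h₁ h₃).Fact_cmInflation`.
KERNEL over its binders — no choice beyond the tree's `cmRealisation`, no new record in the package.
MODEL-N: `hd` (I) −1, `ha` (P, N-G0-iii.6) −1, `hR` (P, N-G0-riem) +1 — as booked in BINDER-TRIAGE §32b.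

Tree-jail simulation of this exact text (namespace `HodgeCMSim.Model`): HOME/mc/pub-hodgecm-mc-axioms-1-g4/scratch/
CMInflationRiemannSim*.lean (see the kit row for md5s and farm verdicts).
-/

noncomputable section

open scoped TensorProduct
open NumberField
open Literature.AlgebraicGeometry.Motives (CMType)
open Literature.AlgebraicGeometry.Motives
open Literature.AlgebraicGeometry.ComplexMultiplication

namespace HodgeCM

namespace Model

open Literature.NumberTheory.Automorphic.PicardCM
open Literature.AlgebraicGeometry.HodgeTheory
open CMTypeOps (inflate)

/-- **M38 `Fact_cmInflation`** on the generic model universe `universeOf hHD hI hU h₃` from Riemann's theorem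
`hR` (and the universe's row `hI`): `thm3_rational_transport_of_riemann` on the chosen realisations of the
codes of `(K, Φ)` and `(M, Φ^M)` (the code CM types are `Φ`, `Φ^M` transported along `cmCodeEquiv`, by `rfl`). -/
theorem universeOf_fact_cmInflation_riemann (hHD : exists_isReal_hodgeModel)
    (hI : hodgePQ_independent_of_hodgeModel) (hU : BallQuotientUniformisedDatum) (h₃ : CMAbelianVarietyRealised)
    (hR : DeligneMilne1982_Thm_6_20_full) :
    (universeOf hHD hI hU h₃).Fact_cmInflation := by
  intro K M k Φ
  obtain ⟨m, p, hbij, hcomm⟩ :=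
    thm3_rational_transport_of_riemann (fun A B ψ _ hB hA₁ hA₂ ↦ hR A B ψ hB ⟨hA₁, hA₂⟩) hI k Φ
      (cmCodeEquiv K Φ) (cmCodeEquiv M (inflate k Φ)) (fun _ ↦ Iff.rfl) (fun _ ↦ Iff.rfl)
      (isCMTypeRealisation_cmRealisation h₃ (cmCode K Φ))
      (isCMTypeRealisation_cmRealisation h₃ (cmCode M (inflate k Φ)))
      ((cmRealisation h₃ (cmCode K Φ)).exists_map_comp (cmCodeEquiv K Φ))
      ((cmRealisation h₃ (cmCode M (inflate k Φ))).exists_map_comp (cmCodeEquiv M (inflate k Φ)))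
  exact ⟨m, p, hbij, hcomm⟩

/-- **M38 `Fact_cmInflation` on the end-state universe `picardCMUniverse`, from Riemann's theorem** (node-E
binder `h31`, rev 3): `h31 := HodgeCM.Model.fact_cmInflation_riemann hHD hI h₃ h₁ hR`. KERNEL over the rows
`hHD`, `hI`, (iii), (ii-a), (ii-b) of the universe and the ONE print binder `hR` (Deligne–Milne 1982, Thm. 6.20). -/
theorem fact_cmInflation_riemann (hHD : exists_isReal_hodgeModel) (hI : hodgePQ_independent_of_hodgeModel)
    (h₃ : CMAbelianVarietyRealised) (h₁ : BallQuotientUniformised)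
    (hR : DeligneMilne1982_Thm_6_20_full) :
    (picardCMUniverse hHD hI h₁ h₃).Fact_cmInflation :=
  universeOf_fact_cmInflation_riemann hHD hI _ h₃ hR

end Model

end HodgeCM

end
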